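import Summits.BirchSwinnertonDyer.Rank1Residual.AdditivePotMult.PotMultGreenbergKummerIdentification
import Summits.BirchSwinnertonDyer.Rank1Residual.AdditivePotMult.RamifiedOrdinaryLineUniquePotMult
import Summits.BirchSwinnertonDyer.Rank1Residual.Additive.RamifiedOrdinaryLineTorsionFixed
import HarnessLib

/-!
# `Additive.RamifiedLineKummerEqAt W p` on every potentially multiplicative row, mod A40/A41: R-D over
# `ℚ_∞` — Kummer = Greenberg = strict — for EVERY ramified ordinary line (cell `b2b-bsdres`, team
# n1011, seat p07 (gen 5); row T-RD-M, closing file: the `∃ L` identification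
# `PotMultGreenbergKummerIdentification` × cc-typer-2's uniqueness `RamifiedOrdinaryLineUniquePotMult`)

HONEST FRAMING (cell `b2b-bsdres`, run/shared/lean/b2b/bsd-rank1-residual/, verbatim in every
file): the goal of the cell is to DELETE the COMBINATION-SHAPED residual classes of the
Birch–Swinnerton-Dyer formula for ALL analytic-rank `≤ 1` elliptic curves over `ℚ` — "full BSD
formula for every rank `≤ 1` curve in class `C`" assembled STRICTLY from published theorems — so
that the rank-`≤ 1` remainder becomes exactly the CONSTRUCTION-SHAPED classes, which are TYPED
(missing-input `Prop`s), NOT attempted. This is not "finishing BSD". Team n1011 (N10/N11, (M) rows):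
research route; labels and marks UNCHANGED; nothing booked. Theorems only; NO definition; NO
Literature fact; the ONLY named facts are the published Tate uniformisation A40/A41 (`hT40`/`hT41`).
Debt 0.

## What

cc-typer-2's binder `Additive.RamifiedLineKummerEqAt W p` (`CongruentLambdaShiftOfGVTorsionIso` §0;
the R-D input of the GV record `muLambdaAlg_transfer_of_torsionIso_potOrd_of_not_dvd_torsionOrder`)
reads: for every cyclotomic `κ`, every `v ∋ p` and EVERY ramified ordinary line `L` at `v`
(`EmertonPollackWeston2006.IsRamifiedOrdinaryLine W p L`),
`L.greenbergKer (ker κ) = W.localKerOver p (ker κ) ℚ_v`. For `E = W` additive and potentially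
multiplicative at the odd prime `p` (`PotMult W p`; X4(M) `ClassX4M`, X3♯(M) `ClassX3M`; every odd
`p`, `p = 3` included; no image hypothesis) it is DISCHARGED here modulo A40/A41 ONLY:
* `PotMult.ramifiedLineKummerEqAt`, `ClassX4M.ramifiedLineKummerEqAt`, `ClassX3M.ramifiedLineKummerEqAt`
  — cc-typer-2's adapter `PotMult.ramifiedLineKummerEqAt_of_exists` (uniqueness of the ramified
  ordinary line on (M), `RamifiedOrdinaryLineUniquePotMult`, itself on this seat's all-level Tate line
  package `PotMultTateLineAllLevel`) fed with this seat's `∃ L` identification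
  `PotMult.exists_isRamifiedOrdinaryLine_kummer` (`PotMultGreenbergKummerIdentification`: X2's Tate
  parametrisation on the multiplicative `p*`-twist model, n1011-p05's twist transports and prime-to-`p`
  descent, this seat's ascent);
* the per-line identities in BOTH currencies and their agreement, for every ramified ordinary `L`:
  `PotMult.greenbergKer_eq_localKerOver_of_isRamifiedOrdinaryLine`,
  `PotMult.strictKer_eq_localKerOver_of_isRamifiedOrdinaryLine`,
  `PotMult.greenbergKer_eq_strictKer_of_isRamifiedOrdinaryLine` (+ `ClassX4M.` / `ClassX3M.` strict
  forms);
* §0 (folklore, any `W/ℚ`): a ramified ordinary line meets `E[p^∞][p]` in exactly `p` elements,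
  `RamifiedLineUnique.natCard_plus_inf_torsionBy_eq` — hypothesis (b) of cc-typer-2's datum-level
  `LocalDatum.plus_eq_of_inertia_scalar` READ OFF EPW's binder (`#E[p^∞][p] = p²` and
  `E[p^∞][p] ⊄ C` are n1011-p12's `natCard_torsionBy_geomPrimaryTorsion` / `plus_eq_top_of_torsionBy_le`).
X4(M) / X3♯(M) stay CONSTRUCTION-SHAPED; nothing booked; no mark moved.

References: R. Greenberg, LNM 1716 (1999) §2 pp. 74–76, §5 p. 143; R. Greenberg, V. Vatsal, Invent.
Math. 142 (2000) §2 pp. 14–16, p. 26; M. Emerton, R. Pollack, T. Weston, Invent. Math. 163 (2006)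
§3.1; J. H. Silverman, *ATAEC* V.5.3, Cor. V.5.4; *AEC* III.6.4 (b).
-/

noncomputable section

open scoped Classical NumberField AddSubgroup

namespace Summit.BirchSwinnertonDyer.Rank1Residual.AdditivePotMult

open NumberField IsDedekindDomain Field WeierstrassCurve
  Literature.NumberTheory.EllipticCurves
  Literature.NumberTheory.EllipticCurves.GreenbergSelmer
  Literature.NumberTheory.EllipticCurves.EmertonPollackWeston2006
  Literature.NumberTheory.GaloisRepresentations
  Summit.BirchSwinnertonDyer.Rank1Residual.X2
  Summit.BirchSwinnertonDyer.Rank1Residual.Additive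

/-! ### §0 Folklore: a ramified ordinary line meets `E[p^∞][p]` in exactly `p` elements -/

namespace RamifiedLineUnique

variable {W : WeierstrassCurve ℚ} {p : ℕ} [hp : Fact p.Prime] {v : HeightOneSpectrum (𝓞 ℚ)}

omit hp in
/-- In the `p`-primary `E[p^∞]`, a subgroup meeting `E[p^∞][p]` trivially is trivial. [folklore] -/
theorem eq_bot_of_inf_torsionBy_eq_bot (S : AddSubgroup (W.geomPrimaryTorsion p))
    (hS : S ⊓ AddSubgroup.torsionBy (W.geomPrimaryTorsion p) (p : ℤ) = ⊥) : S = ⊥ := by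
  have key : ∀ k : ℕ, ∀ x ∈ S, p ^ k • x = 0 → x = 0 := by
    intro k
    induction k with
    | zero => intro x _ hk; rwa [pow_zero, one_nsmul] at hk
    | succ k ih =>
      intro x hx hk
      rw [pow_succ, mul_nsmul'] at hk
      have hpx : p • x = 0 := ih (p • x) (S.nsmul_mem hx p) hk
      have hmem : x ∈ S ⊓ AddSubgroup.torsionBy (W.geomPrimaryTorsion p) (p : ℤ) :=
        AddSubgroup.mem_inf.2 ⟨hx, AddSubgroup.torsionBy.nsmul_iff.mpr hpx⟩
      rw [hS] at hmem
      exact hmem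
  rw [eq_bot_iff]
  intro x hx
  obtain ⟨k, hk⟩ := RamifiedOrdinaryLineUnique.exists_pow_nsmul_eq_zero W p x
  exact key k x hx hk

/-- **A ramified ordinary line meets `E[p^∞][p]` in a subgroup of order exactly `p`** (`≠ 1`: it is a
non-zero `p`-primary group; `≠ p²`: else it contains `E[p^∞][p]` and, being `p`-divisible, is all of
`E[p^∞]` — n1011-p12's `plus_eq_top_of_torsionBy_le`; `#E[p^∞][p] = p²`, his
`natCard_torsionBy_geomPrimaryTorsion`, Silverman *AEC* III.6.4 (b)). The converse of
`RamifiedOrdinaryLinePotMult.plus_ne_bot_of_natCard` / `plus_ne_top_of_natCard`; hypothesis (b) of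
`LocalDatum.plus_eq_of_inertia_scalar`, for any ramified ordinary line.
[cite: EmertonPollackWeston2006, §3.1 (eq:ordes) (arXiv:math/0404484 p. 17)] [cite: SilvermanAEC2009, Cor. III.6.4(b)] -/
theorem natCard_plus_inf_torsionBy_eq [W.IsElliptic] {L : LocalDatum ℚ (W.geomPrimaryTorsion p) v}
    (hL : IsRamifiedOrdinaryLine W p L) :
    Nat.card ↥(L.plus ⊓ AddSubgroup.torsionBy (↥(W.geomPrimaryTorsion p)) (p : ℤ)) = p := by
  set T := AddSubgroup.torsionBy (↥(W.geomPrimaryTorsion p)) (p : ℤ) with hT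
  have hsq : Nat.card T = p ^ 2 := natCard_torsionBy_geomPrimaryTorsion (W := W) (p := p)
  haveI : Finite T := Nat.finite_of_card_ne_zero (by rw [hsq]; exact pow_ne_zero 2 hp.out.ne_zero)
  have hdvd : Nat.card ↥(L.plus ⊓ T) ∣ p ^ 2 := by
    rw [← hsq]
    exact AddSubgroup.card_dvd_of_le inf_le_right
  rcases (Nat.dvd_prime_pow hp.out).1 hdvd with ⟨i, hi, hci⟩
  interval_cases i
  · -- `#(L ⊓ E[p^∞][p]) = 1`: then `L = ⊥`, contradicting clause 3
    exfalso
    rw [pow_zero] at hci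
    exact hL.plus_ne_bot (eq_bot_of_inf_torsionBy_eq_bot L.plus (AddSubgroup.eq_bot_of_card_eq _ hci))
  · rw [pow_one] at hci; exact hci
  · -- `#(L ⊓ E[p^∞][p]) = p²`: then `E[p^∞][p] ≤ L`, so `L = ⊤` by divisibility — contradiction
    exfalso
    have hXT : L.plus ⊓ T = T :=
      AddSubgroup.eq_of_le_of_card_ge inf_le_right (by rw [hci, hsq])
    exact hL.plus_ne_top (plus_eq_top_of_torsionBy_le L (fun c hc ↦ hL.divisible hc)
      (by rw [← hT, ← hXT]; exact inf_le_left))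

end RamifiedLineUnique

/-! ### §1 `RamifiedLineKummerEqAt` on (M), and R-D for every ramified ordinary line -/

section Classes

variable {W : WeierstrassCurve ℚ} [W.IsElliptic] {p : ℕ} [hp : Fact p.Prime]

/-- **cc-typer-2's binder `Additive.RamifiedLineKummerEqAt W p` DISCHARGED on every potentially
multiplicative row, every odd `p`, modulo the published Tate uniformisation A40/A41 ONLY**: the
adapter `PotMult.ramifiedLineKummerEqAt_of_exists` (uniqueness of the ramified ordinary line) fed
with the `∃ L` identification `PotMult.exists_isRamifiedOrdinaryLine_kummer`. Nothing booked;
X4(M)/X3♯(M) stay CONSTRUCTION-SHAPED. [cite: GreenbergLNM1716, §2 pp. 74–76 and §5 p. 143]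
[cite: GreenbergVatsal2000, §2 p. 16 and p. 26] [cite: SilvermanATAEC1994, Ch. V Thm. 5.3, Cor. 5.4] -/
theorem PotMult.ramifiedLineKummerEqAt (hT40 : Silverman1994_thmV53_tateUniformisation.{0})
    (hT41 : Silverman1994_thmV53_corV54_tateUniformisation.{0}) (hp2 : p ≠ 2) (hpm : PotMult W p) :
    Additive.RamifiedLineKummerEqAt W p :=
  hpm.ramifiedLineKummerEqAt_of_exists hT40 hT41 hp2 fun κ hκ _ hv ↦ by
    obtain ⟨L, hL, hgr, -⟩ := hpm.exists_isRamifiedOrdinaryLine_kummer hT40 hT41 hp2 κ hκ hv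
    exact ⟨L, hL, hgr⟩

/-- **R-D for EVERY ramified ordinary line on (M), Greenberg currency**: `L.greenbergKer (ker κ) =
W.localKerOver p (ker κ) ℚ_v` for every ramified ordinary `L` at `v ∋ p` and every cyclotomic `κ`,
mod A40/A41 (unfolding of `PotMult.ramifiedLineKummerEqAt`). [cite: GreenbergLNM1716, §2 pp. 74–76 and §5 p. 143]
[cite: GreenbergVatsal2000, §2 p. 26] [cite: SilvermanATAEC1994, Ch. V Thm. 5.3, Cor. 5.4] -/
theorem PotMult.greenbergKer_eq_localKerOver_of_isRamifiedOrdinaryLine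
    (hT40 : Silverman1994_thmV53_tateUniformisation.{0})
    (hT41 : Silverman1994_thmV53_corV54_tateUniformisation.{0}) (hp2 : p ≠ 2) (hpm : PotMult W p)
    (κ : ZpExtension ℚ p) (hκ : κ.IsCyclotomic)
    {v : HeightOneSpectrum (𝓞 ℚ)} (hv : ((p : ℕ) : 𝓞 ℚ) ∈ v.asIdeal)
    {L : LocalDatum ℚ (W.geomPrimaryTorsion p) v} (hL : IsRamifiedOrdinaryLine W p L) :
    L.greenbergKer κ.kerSubgroup = W.localKerOver p κ.kerSubgroup (v.adicCompletion ℚ) :=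
  hpm.ramifiedLineKummerEqAt hT40 hT41 hp2 κ hκ v hv L hL

/-- **R-D for EVERY ramified ordinary line on (M), strict currency**: `L.strictKer (ker κ) =
W.localKerOver p (ker κ) ℚ_v`, mod A40/A41 (the `∃ L` identification in the strict currency +
cc-typer-2's uniqueness `PotMult.eq_of_isRamifiedOrdinaryLine`). [cite: GreenbergLNM1716, §2 pp. 74–76 and §5 p. 143]
[cite: SilvermanATAEC1994, Ch. V Thm. 5.3, Cor. 5.4] -/
theorem PotMult.strictKer_eq_localKerOver_of_isRamifiedOrdinaryLine
    (hT40 : Silverman1994_thmV53_tateUniformisation.{0})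
    (hT41 : Silverman1994_thmV53_corV54_tateUniformisation.{0}) (hp2 : p ≠ 2) (hpm : PotMult W p)
    (κ : ZpExtension ℚ p) (hκ : κ.IsCyclotomic)
    {v : HeightOneSpectrum (𝓞 ℚ)} (hv : ((p : ℕ) : 𝓞 ℚ) ∈ v.asIdeal)
    {L : LocalDatum ℚ (W.geomPrimaryTorsion p) v} (hL : IsRamifiedOrdinaryLine W p L) :
    L.strictKer κ.kerSubgroup = W.localKerOver p κ.kerSubgroup (v.adicCompletion ℚ) := by
  obtain ⟨L₀, hL₀, -, hst⟩ := hpm.exists_isRamifiedOrdinaryLine_kummer hT40 hT41 hp2 κ hκ hv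
  rw [hpm.eq_of_isRamifiedOrdinaryLine hT40 hT41 hp2 hv hL hL₀]
  exact hst

/-- **Greenberg = strict at `ker κ` for EVERY ramified ordinary line on (M)**, mod A40/A41 (both equal
the Kummer image). [cite: GreenbergLNM1716, §2 pp. 74–76] [cite: SilvermanATAEC1994, Ch. V Thm. 5.3, Cor. 5.4] -/
theorem PotMult.greenbergKer_eq_strictKer_of_isRamifiedOrdinaryLine
    (hT40 : Silverman1994_thmV53_tateUniformisation.{0})
    (hT41 : Silverman1994_thmV53_corV54_tateUniformisation.{0}) (hp2 : p ≠ 2) (hpm : PotMult W p)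
    (κ : ZpExtension ℚ p) (hκ : κ.IsCyclotomic)
    {v : HeightOneSpectrum (𝓞 ℚ)} (hv : ((p : ℕ) : 𝓞 ℚ) ∈ v.asIdeal)
    {L : LocalDatum ℚ (W.geomPrimaryTorsion p) v} (hL : IsRamifiedOrdinaryLine W p L) :
    L.greenbergKer κ.kerSubgroup = L.strictKer κ.kerSubgroup :=
  (hpm.greenbergKer_eq_localKerOver_of_isRamifiedOrdinaryLine hT40 hT41 hp2 κ hκ hv hL).trans
    (hpm.strictKer_eq_localKerOver_of_isRamifiedOrdinaryLine hT40 hT41 hp2 κ hκ hv hL).symm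

/-- **X4(M), every odd `p` (`p = 3` included): `Additive.RamifiedLineKummerEqAt W p`** — R-D over
`ℚ_∞` for EVERY ramified ordinary line (Route G's binder, `∀ L` form), mod A40/A41. X4(M) stays
CONSTRUCTION-SHAPED; nothing booked. [cite: GreenbergLNM1716, §2 pp. 74–76] [cite: GreenbergVatsal2000, §2 p. 26]
[cite: SilvermanATAEC1994, Ch. V Thm. 5.3, Cor. 5.4] -/
theorem ClassX4M.ramifiedLineKummerEqAt (hT40 : Silverman1994_thmV53_tateUniformisation.{0})
    (hT41 : Silverman1994_thmV53_corV54_tateUniformisation.{0}) (hX : ClassX4M W p) :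
    Additive.RamifiedLineKummerEqAt W p :=
  (ClassX4M.potMult W p hX).ramifiedLineKummerEqAt hT40 hT41 hX.p_ne_two

/-- **X4(M): strict currency for every ramified ordinary line**, mod A40/A41. [cite: GreenbergLNM1716, §2 pp. 74–76]
[cite: SilvermanATAEC1994, Ch. V Thm. 5.3, Cor. 5.4] -/
theorem ClassX4M.strictKer_eq_localKerOver_of_isRamifiedOrdinaryLine
    (hT40 : Silverman1994_thmV53_tateUniformisation.{0})
    (hT41 : Silverman1994_thmV53_corV54_tateUniformisation.{0}) (hX : ClassX4M W p)
    (κ : ZpExtension ℚ p) (hκ : κ.IsCyclotomic)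
    {v : HeightOneSpectrum (𝓞 ℚ)} (hv : ((p : ℕ) : 𝓞 ℚ) ∈ v.asIdeal)
    {L : LocalDatum ℚ (W.geomPrimaryTorsion p) v} (hL : IsRamifiedOrdinaryLine W p L) :
    L.strictKer κ.kerSubgroup = W.localKerOver p κ.kerSubgroup (v.adicCompletion ℚ) :=
  (ClassX4M.potMult W p hX).strictKer_eq_localKerOver_of_isRamifiedOrdinaryLine hT40 hT41 hX.p_ne_two
    κ hκ hv hL

/-- **X3♯(M), every odd `p` (`p = 3` included): `Additive.RamifiedLineKummerEqAt W p`**, mod A40/A41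
(no image hypothesis — R8). X3♯(M) stays CONSTRUCTION-SHAPED; nothing booked.
[cite: GreenbergLNM1716, §2 pp. 74–76] [cite: GreenbergVatsal2000, §2 p. 26]
[cite: SilvermanATAEC1994, Ch. V Thm. 5.3, Cor. 5.4] -/
theorem ClassX3M.ramifiedLineKummerEqAt [W.IsGloballyMinimal]
    (hT40 : Silverman1994_thmV53_tateUniformisation.{0})
    (hT41 : Silverman1994_thmV53_corV54_tateUniformisation.{0}) (hX : ClassX3M W p) :
    Additive.RamifiedLineKummerEqAt W p :=
  (ClassX3M.potMult W p hX).ramifiedLineKummerEqAt hT40 hT41 (ClassX3M.p_ne_two W p hX)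

/-- **X3♯(M): strict currency for every ramified ordinary line**, mod A40/A41 (no image hypothesis).
[cite: GreenbergLNM1716, §2 pp. 74–76] [cite: SilvermanATAEC1994, Ch. V Thm. 5.3, Cor. 5.4] -/
theorem ClassX3M.strictKer_eq_localKerOver_of_isRamifiedOrdinaryLine [W.IsGloballyMinimal]
    (hT40 : Silverman1994_thmV53_tateUniformisation.{0})
    (hT41 : Silverman1994_thmV53_corV54_tateUniformisation.{0}) (hX : ClassX3M W p)
    (κ : ZpExtension ℚ p) (hκ : κ.IsCyclotomic)
    {v : HeightOneSpectrum (𝓞 ℚ)} (hv : ((p : ℕ) : 𝓞 ℚ) ∈ v.asIdeal)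
    {L : LocalDatum ℚ (W.geomPrimaryTorsion p) v} (hL : IsRamifiedOrdinaryLine W p L) :
    L.strictKer κ.kerSubgroup = W.localKerOver p κ.kerSubgroup (v.adicCompletion ℚ) :=
  (ClassX3M.potMult W p hX).strictKer_eq_localKerOver_of_isRamifiedOrdinaryLine hT40 hT41
    (ClassX3M.p_ne_two W p hX) κ hκ hv hL

end Classes

end Summit.BirchSwinnertonDyer.Rank1Residual.AdditivePotMult

end
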